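import Literature.RingTheory.Etale.EtaleClosedCover
import Literature.RingTheory.Etale.WeaklyEtaleLocalIso
import Literature.RingTheory.Etale.PointedRetractionHenselian
import Mathlib.RingTheory.Henselian
import Mathlib.RingTheory.Flat.FaithfullyFlat.Algebra
import HarnessLib

/-!
# Strictly henselian covers, I: pointed retractions give Hensel's lemma; every local ring maps
# faithfully flatly and locally to a strictly henselian local ring

Topic `Literature/RingTheory/Etale`, namespace `Literature.RingTheory.Etale`.  THEOREMS ONLY (no
definition, no named fact, no instance).

The Stacks Project, Tag 097R, constructs for every ring `X` a faithfully flat ind-étale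
`X`-algebra `C = colim Tⁿ(X)` all of whose faithfully flat étale covers split (in the tree:
`ETower X`, `ETower.retraction`, `EtaleClosedCover.lean`), and Tag 097V–097X conclude that the
local rings of `C` at its maximal ideals are STRICTLY HENSELIAN.  The tree draws from the
retraction property the «pointed retractions» (`hasPointedRetractions_of_retraction`,
`StrictHenselOfSplitting.lean`) and from those the separably closed residue field
(`isSepClosed_residueField`, `PointedRetractionHenselian.lean`) and the two substitutes for
henselianity used by Olivier's theorem — but not Hensel's lemma itself.  This file supplies it and
packages the consequence that matters for arithmetic geometry over a discrete valuation ring: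

* `henselianLocalRing_of_hasPointedRetractions` — **pointed retractions ⇒ Hensel's lemma**: if
  every étale `C`-algebra with a prime `q` over the maximal ideal `m` retracts to `C_m` with
  centre `q`, then `C_m` is a henselian local ring (Mathlib `HenselianLocalRing`): a simple root
  `a₀ ∈ κ(m)` of a monic `F ∈ C_m[X]` is the `κ(m)`-point of the standard étale algebra
  `(B[X]/F₀)[1/F₀']` of a monic model `F₀` of `F` over an étale localization `B = C[1/b]`; the
  pointed retraction through that point is a root of `F` in `C_m` lifting `a₀`
  (Stacks 04GG (7) ⇒ (1)).
* `ETower.henselianLocalRing`, `ETower.isSepClosed_residueField`,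
  `ETower.exists_isMaximal_under_eq` — the local rings of the tower `C = ETower R` at maximal
  ideals are strictly henselian, and over a maximal ideal of `R` there is a maximal ideal of `C`
  (faithful flatness).
* `exists_faithfullyFlat_strictlyHenselian` — **every local ring `R` admits a local, faithfully
  flat homomorphism into a strictly henselian local ring** `R → R'` (`R' = C_𝔪`).
* Sequel `StrictlyHenselianCoverDVR.lean`: for a discrete valuation ring `R` the cover `R'` is a
  discrete valuation ring with `𝔪_R R' = 𝔪_{R'}`.

This is the «strictly henselian faithfully flat extension of a discrete valuation ring» along
which Néron models and birational group laws are constructed before descent (Bosch–Lütkebohmert–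
Raynaud, *Néron Models*, §2.3 Prop. 5 ff., §6.5; M. Artin, *Néron Models*, Notation (4): «strictly
local, meaning henselian, with separably closed residue field»); Mathlib has no (strict)
henselisation, and the tree's Néron files (`NeronModelExistenceLocalSplit.lean`) phrase their
facts over abstract strictly local discrete valuation rings — this file produces one over any
given discrete valuation ring.

## References
* The Stacks Project, Tags 04GG, 097R, 097V, 097W, 097X. [StacksProject]
* B. Bhatt, P. Scholze, *The pro-étale topology for schemes*, Astérisque 369 (2015), Def. 2.2.1,
  Lemma 2.2.9. [BhattScholze2015]
* S. Bosch, W. Lütkebohmert, M. Raynaud, *Néron Models*, Springer 1990, §2.3 (strict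
  henselisation), §6.5. [BLRNeronModels1990]

## Design notes
Mathlib searched/used: `HenselianLocalRing.TFAE`, `StandardEtalePair` (`Ring`, `lift`, `lift_X`,
`hasMap_X`), `IsLocalization.exist_integer_multiples_of_finite`, `Algebra.Etale.of_isLocalizationAway`,
`Module.FaithfullyFlat.of_flat_of_isLocalHom`, `PrimeSpectrum.comap_surjective_of_faithfullyFlat`.  Nothing restated; no strict henselisation
(universal property) is claimed — only the existence of ONE strictly henselian faithfully flat
local extension.
-/

universe u

open Polynomial IsLocalRing

namespace Literature.RingTheory.Etale

noncomputable section

/-! ### Pointed retractions give Hensel's lemma -/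

section Hensel

variable {C : Type u} [CommRing C] {m : Ideal C} [m.IsMaximal]

/-- **Pointed retractions ⇒ henselian** (Stacks 04GG (7) ⇒ (1); the henselian half of Tag 097X
«the local rings of `C` at maximal ideals are strictly henselian»).  If every étale `C`-algebra
with a prime `q` above the maximal ideal `m` admits a `C`-algebra map to `C_m` with centre `q`
(`HasPointedRetractions C m`), then `C_m` satisfies Hensel's lemma: a simple root `a₀ ∈ κ(m)` of a
monic `F ∈ C_m[X]` lifts to a root in `C_m`.  Proof: clear denominators (`F = F₀ ⊗_B C_m` for a
monic `F₀` over an étale localization `B = C[1/b]`), map the standard étale `B`-algebra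
`(B[X]/F₀)[1/F₀']` to `κ(m)` through `a₀`, and retract through the resulting prime.
[cite: StacksProject, Tag 04GG (7) and Tag 097X] -/
theorem henselianLocalRing_of_hasPointedRetractions (h : HasPointedRetractions C m) :
    HenselianLocalRing (Localization.AtPrime m) := by
  classical
  set R := Localization.AtPrime m
  refine ((HenselianLocalRing.TFAE R).out 0 1).2 fun F hF a₀ ha₀ ha₀' => ?_
  set d := F.natDegree
  -- clear denominators of the coefficients of `F`
  obtain ⟨b, hb⟩ := IsLocalization.exist_integer_multiples_of_finite m.primeCompl
    (fun i : Fin d => F.coeff i)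
  choose c hc using hb
  let B := Localization.Away (b : C)
  haveI : Algebra.Etale C B := Algebra.Etale.of_isLocalizationAway (b : C)
  have hbR : IsUnit (algebraMap C R b) :=
    (IsLocalization.AtPrime.isUnit_to_map_iff R m (b : C)).2 b.2
  letI : Algebra B R := (IsLocalization.Away.lift (b : C) hbR).toAlgebra
  haveI : IsScalarTower C B R := IsScalarTower.of_algebraMap_eq fun x =>
    (IsLocalization.Away.lift_eq (b : C) hbR x).symm
  have hbB : IsUnit (algebraMap C B b) := IsLocalization.Away.algebraMap_isUnit (b : C)
  -- the monic model `F₀` over `B`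
  let q₀ : Fin d → B := fun i => algebraMap C B (c i) * ↑(hbB.unit⁻¹)
  let F₀ : B[X] := X ^ d + polyOf q₀
  have hF₀ : F₀.Monic := monic_X_pow_add (degree_polyOf_lt q₀)
  have hq₀ : ∀ i, algebraMap B R (q₀ i) = F.coeff i := by
    intro i
    have e1 : (↑(hbB.unit⁻¹) : B) * algebraMap C B b = 1 := hbB.unit.inv_mul
    have h1 : algebraMap B R ↑(hbB.unit⁻¹) * algebraMap C R b = 1 := by
      rw [IsScalarTower.algebraMap_apply C B R, ← map_mul, e1, map_one]
    have h2 : algebraMap C R (c i) = algebraMap C R b * F.coeff i := by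
      rw [hc i, Algebra.smul_def]
    change algebraMap B R (algebraMap C B (c i) * ↑(hbB.unit⁻¹)) = F.coeff i
    rw [map_mul, ← IsScalarTower.algebraMap_apply, h2]
    calc algebraMap C R ↑b * F.coeff ↑i * algebraMap B R ↑(hbB.unit⁻¹)
        = (algebraMap B R ↑(hbB.unit⁻¹) * algebraMap C R b) * F.coeff i := by ring
      _ = F.coeff i := by rw [h1, one_mul]
  have hF₀F : F₀.map (algebraMap B R) = F := by
    have : F₀.map (algebraMap B R) = X ^ d + polyOf (fun i : Fin d => F.coeff i) := by
      simp only [F₀, Polynomial.map_add, Polynomial.map_pow, map_X, polyOf_map]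
      congr 2; exact funext hq₀
    have hFsum : F = X ^ d + polyOf (fun i : Fin d => F.coeff i) := by
      conv_lhs => rw [hF.as_sum, Finset.sum_range]
      rfl
    rw [this, ← hFsum]
  -- the residue field as a `B`-algebra
  letI : Algebra B (ResidueField R) := ((residue R).comp (algebraMap B R)).toAlgebra
  haveI : IsScalarTower B R (ResidueField R) := IsScalarTower.of_algebraMap_eq fun x => rfl
  haveI : IsScalarTower C B (ResidueField R) := IsScalarTower.of_algebraMap_eq fun x => by
    rw [IsScalarTower.algebraMap_apply C R (ResidueField R), IsScalarTower.algebraMap_apply C B R]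
    rfl
  -- the standard étale algebra `(B[X]/F₀)[1/F₀']` and its `κ`-point `a₀`
  let P : StandardEtalePair B := ⟨F₀, hF₀, derivative F₀, 1, 0, 1, by simp⟩
  have hmap : P.HasMap a₀ := by
    constructor
    · change aeval a₀ F₀ = 0
      rw [← aeval_map_algebraMap R a₀ F₀, hF₀F]
      exact ha₀
    · change IsUnit (aeval a₀ (derivative F₀))
      rw [← aeval_map_algebraMap R a₀ (derivative F₀), ← derivative_map, hF₀F]
      exact isUnit_iff_ne_zero.2 ha₀'
  let g : P.Ring →ₐ[B] ResidueField R := P.lift a₀ hmap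
  -- `P.Ring` as an étale `C`-algebra
  letI : Algebra C P.Ring := ((algebraMap B P.Ring).comp (algebraMap C B)).toAlgebra
  haveI : IsScalarTower C B P.Ring := IsScalarTower.of_algebraMap_eq fun x => rfl
  haveI : Algebra.Etale C P.Ring := Algebra.Etale.comp C B P.Ring
  -- the prime below the point lies over `m`
  let q : Ideal P.Ring := RingHom.ker g.toRingHom
  haveI : q.IsPrime := RingHom.ker_isPrime _
  have hq : q.under C = m := by
    ext x
    rw [Ideal.under_def, Ideal.mem_comap, RingHom.mem_ker, AlgHom.toRingHom_eq_coe,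
      AlgHom.coe_toRingHom, IsScalarTower.algebraMap_apply C B P.Ring, AlgHom.commutes,
      ← IsScalarTower.algebraMap_apply, IsScalarTower.algebraMap_apply C R (ResidueField R),
      IsLocalRing.ResidueField.algebraMap_eq, IsLocalRing.residue_eq_zero_iff]
    exact IsLocalization.AtPrime.to_map_mem_maximal_iff R m x
  -- the pointed retraction, as a `B`-algebra map
  obtain ⟨r, hr⟩ := h P.Ring q hq
  have hrB : ∀ x : B, r (algebraMap B P.Ring x) = algebraMap B R x := by
    intro x
    have : r.toRingHom.comp (algebraMap B P.Ring) = algebraMap B R := by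
      refine IsLocalization.ringHom_ext (Submonoid.powers (b : C)) ?_
      ext y
      simp only [RingHom.coe_comp, Function.comp_apply, AlgHom.toRingHom_eq_coe,
        AlgHom.coe_toRingHom]
      rw [← IsScalarTower.algebraMap_apply, AlgHom.commutes, IsScalarTower.algebraMap_apply C B R]
    exact DFunLike.congr_fun this x
  let r' : P.Ring →ₐ[B] R := { r.toRingHom with commutes' := hrB }
  let ρ : R →ₐ[B] ResidueField R := { residue R with commutes' := fun x => rfl }
  -- the two `κ`-points agree
  have hρr : ρ.comp r' = g := by
    have h1 : (ρ.comp r').restrictScalars C = g.restrictScalars C := by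
      refine algHom_residueField_ext _ _ fun y hy => ?_
      change residue R (r y) = 0
      rw [IsLocalRing.residue_eq_zero_iff, ← Ideal.mem_comap, hr]
      exact hy
    exact AlgHom.ext fun y => DFunLike.congr_fun h1 y
  -- the root
  refine ⟨r' P.X, ?_, ?_⟩
  · change (F.eval (r' P.X)) = 0
    rw [← hF₀F, eval_map_algebraMap, aeval_algHom_apply, P.hasMap_X.1, map_zero]
  · change ρ (r' P.X) = a₀
    rw [← AlgHom.comp_apply, hρr]
    exact P.lift_X a₀ hmap

end Hensel

/-! ### The local rings of the tower `ETower R` at its maximal ideals are strictly henselian -/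

section Tower

variable (R : Type u) [CommRing R]

/-- The tower `C = colim Tⁿ(R)` has pointed retractions at every maximal ideal (every faithfully
flat étale `C`-algebra retracts, Stacks 097R, whence Stacks 097X). [cite: StacksProject, Tag 097X] -/
theorem ETower.hasPointedRetractions (𝔪 : Ideal (ETower R)) [𝔪.IsMaximal] :
    HasPointedRetractions (ETower R) 𝔪 :=
  hasPointedRetractions_of_retraction (fun Y _ _ _ _ => ETower.retraction R Y) 𝔪

/-- **The local rings of `C = colim Tⁿ(R)` at maximal ideals are henselian** (Stacks 097V/097X).
[cite: StacksProject, Tag 097X] -/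
theorem ETower.henselianLocalRing (𝔪 : Ideal (ETower R)) [𝔪.IsMaximal] :
    HenselianLocalRing (Localization.AtPrime 𝔪) :=
  henselianLocalRing_of_hasPointedRetractions (ETower.hasPointedRetractions R 𝔪)

/-- **… with separably closed residue fields** (Stacks 097V/097X; Bhatt–Scholze Lemma 2.2.9).
[cite: StacksProject, Tag 097X] -/
theorem ETower.isSepClosed_residueField (𝔪 : Ideal (ETower R)) [𝔪.IsMaximal] :
    IsSepClosed 𝔪.ResidueField :=
  Literature.RingTheory.Etale.isSepClosed_residueField (ETower.hasPointedRetractions R 𝔪)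

/-- Over every maximal ideal `p` of `R` lies a maximal ideal of the faithfully flat tower
`C = colim Tⁿ(R)`. [cite: StacksProject, Tag 097R] -/
theorem ETower.exists_isMaximal_under_eq (p : Ideal R) [hp : p.IsMaximal] :
    ∃ 𝔪 : Ideal (ETower R), 𝔪.IsMaximal ∧ 𝔪.under R = p := by
  obtain ⟨Q, hQ⟩ :=
    PrimeSpectrum.comap_surjective_of_faithfullyFlat (A := R) (B := ETower R) ⟨p, hp.isPrime⟩
  obtain ⟨𝔪, h𝔪, hQ𝔪⟩ := Ideal.exists_le_maximal Q.asIdeal Q.2.ne_top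
  refine ⟨𝔪, h𝔪, ?_⟩
  have hQp : Q.asIdeal.under R = p := congrArg PrimeSpectrum.asIdeal hQ
  have h1 : p ≤ 𝔪.under R := by
    rw [← hQp, Ideal.under_def, Ideal.under_def]
    exact Ideal.comap_mono hQ𝔪
  exact (hp.eq_of_le (Ideal.comap_ne_top _ h𝔪.ne_top) h1).symm

/-- **Every local ring admits a local, faithfully flat homomorphism into a strictly henselian
local ring** — namely into the local ring of the ind-étale tower `C = colim Tⁿ(R)` at a maximal
ideal above `𝔪_R` (Stacks 097R/097X; the existence half of the strict henselisation, without its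
universal property). [cite: StacksProject, Tag 097X] [cite: BhattScholze2015, Lemma 2.2.9] -/
theorem exists_faithfullyFlat_strictlyHenselian [IsLocalRing R] :
    ∃ (R' : Type u) (_ : CommRing R') (_ : Algebra R R') (_ : HenselianLocalRing R'),
      IsSepClosed (ResidueField R') ∧ Module.FaithfullyFlat R R' ∧
        IsLocalHom (algebraMap R R') := by
  obtain ⟨𝔪, h𝔪, h𝔪R⟩ := ETower.exists_isMaximal_under_eq R (maximalIdeal R)
  haveI : HenselianLocalRing (Localization.AtPrime 𝔪) := ETower.henselianLocalRing R 𝔪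
  have hloc : IsLocalHom (algebraMap R (Localization.AtPrime 𝔪)) := by
    refine ⟨fun x hx => ?_⟩
    by_contra hxu
    have hxm : algebraMap R (ETower R) x ∈ 𝔪 := by
      rw [← Ideal.mem_comap, ← Ideal.under_def, h𝔪R]; exact hxu
    have : algebraMap R (Localization.AtPrime 𝔪) x ∈ maximalIdeal _ := by
      rw [IsScalarTower.algebraMap_apply R (ETower R) (Localization.AtPrime 𝔪)]
      exact (IsLocalization.AtPrime.to_map_mem_maximal_iff _ 𝔪 _).2 hxm
    exact (IsLocalRing.mem_maximalIdeal _).1 this hx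
  haveI := hloc
  haveI : Module.FaithfullyFlat R (Localization.AtPrime 𝔪) :=
    Module.FaithfullyFlat.of_flat_of_isLocalHom
  exact ⟨Localization.AtPrime 𝔪, inferInstance, inferInstance, inferInstance,
    ETower.isSepClosed_residueField R 𝔪, inferInstance, hloc⟩

end Tower

end

end Literature.RingTheory.Etale
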